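import Literature.NumberTheory.GaloisRepresentations.DiscreteModuleInverseLimit
import HarnessLib

/-!
# Continuous cohomology of an inverse limit of discrete modules, II: `H²_cont(G, lim M_n) ≅ lim H²(G, M_n)`

Neukirch–Schmidt–Wingberg, *Cohomology of Number Fields* (2nd ed. 2008), II §7 Thm. (2.7.5) and its
corollary (Tate 1976 §2; finite-group analogue: Harari (2017) Prop. 1.31 p. 44, held
`book:harari2017-galois-cohomology-class-field-theory` p0044), in degree `2`, for the inverse systems
`S : DiscreteInvSystem G ι` of the prequel (`DiscreteModuleInverseLimit.lean`) and a locally compact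
topological group `G`:

* `S.exists_twoCocycle_proj_eq` — SURJECTIVITY of `H²_cont(G, lim_n M_n) → lim_n H²(G, M_n)` when
  the transition maps are surjective and the index set has a cofinal chain: exact lifting of
  continuous inhomogeneous `2`-cocycles along the chain (a continuous section of `M_m ↠ M_n` exists
  because `M_n` is discrete; subtract the coboundary of the lifted `1`-cochain), then extension to
  all indices and assembly into a cocycle of the limit (`S.limitCocycle₂`);
* `S.twoCocycleClass_eq_zero_of_proj` — INJECTIVITY when the groups `Z¹(G, M_n)` of continuous
  crossed homomorphisms are finite: the continuous solutions `b` of `∂b = f_n` form finite non-empty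
  sets (torsors under `Z¹(G, M_n)`), so König's lemma (Mathlib's
  `nonempty_sections_of_finite_inverse_system`) gives a compatible family of solutions, which
  assembles to a continuous `1`-cochain of the limit bounding `f` — this is the Mittag-Leffler
  argument of the printed proof for the `lim¹`-term;
* `S.continuousCohomologyTwoLimitEquiv` — the packaged isomorphism
  `H²_cont(G, lim_n M_n) ≃+ lim_n H²(G, M_n)` (`S.cohomologyLimit 2` = compatible families of
  classes), with coordinates `H²(proj_n)`.

Definitions with bodies and theorems; no named fact, no `sorry`.  Cell abc-iut, layer L4 (consumer:
[AbsTopIII] Cor. 1.10 (i)(a) `H²(G_k, μ_Ẑ(G_k)) ≅ Ẑ`), but free of any number theory.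
-/

noncomputable section

open CategoryTheory Function

universe v

namespace Literature.NumberTheory.GaloisRepresentations

namespace DiscreteInvSystem

open _root_.TopRep _root_.ContRepresentation _root_.ContinuousCohomology Opposite

variable {G : Type v} [Group G] [TopologicalSpace G] [IsTopologicalGroup G] [LocallyCompactSpace G]
  {ι : Type} {M : ι → Type v} [∀ n, AddCommGroup (M n)] [∀ n, TopologicalSpace (M n)]
  [∀ n, DiscreteTopology (M n)] (S : DiscreteInvSystem G M)

/-! ### Transition maps and projections on continuous `2`-cocycles -/

/-- `red` on continuous inhomogeneous `2`-cocycles. [cite: NeukirchSchmidtWingberg2008, II §7 Thm 2.7.5] -/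
def redCocycle₂ {n m : ι} (h : S.le n m) (f : contTwoCocycles (S.ρ m).toTopRep) :
    contTwoCocycles (S.ρ n).toTopRep :=
  contTwoCocycles.pullback (ContinuousMonoidHom.id G) (resIdHom (S.redHom h)) f

/-- The projection `lim M → M n` on continuous inhomogeneous `2`-cocycles. [cite: NeukirchSchmidtWingberg2008, II §7 Thm 2.7.5] -/
def projCocycle₂ (n : ι) (f : contTwoCocycles S.limitRep.toTopRep) :
    contTwoCocycles (S.ρ n).toTopRep :=
  contTwoCocycles.pullback (ContinuousMonoidHom.id G) (resIdHom (S.projHom n)) f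

omit [IsTopologicalGroup G] [LocallyCompactSpace G] in
/-- `redCocycle₂` on values. [cite: NeukirchSchmidtWingberg2008, II §7 Thm 2.7.5] -/
@[simp] theorem redCocycle₂_apply {n m : ι} (h : S.le n m) (f : contTwoCocycles (S.ρ m).toTopRep)
    (p : G × G) : (S.redCocycle₂ h f).1 p = S.red h (f.1 p) := rfl

omit [IsTopologicalGroup G] [LocallyCompactSpace G] in
/-- `projCocycle₂` on values. [cite: NeukirchSchmidtWingberg2008, II §7 Thm 2.7.5] -/
@[simp] theorem projCocycle₂_apply (n : ι) (f : contTwoCocycles S.limitRep.toTopRep) (p : G × G) :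
    (S.projCocycle₂ n f).1 p = (f.1 p : ∀ n, M n) n := rfl

omit [IsTopologicalGroup G] [LocallyCompactSpace G] in
/-- Functoriality of `redCocycle₂`: identities. [cite: NeukirchSchmidtWingberg2008, II §7 Thm 2.7.5] -/
theorem redCocycle₂_refl (n : ι) (f : contTwoCocycles (S.ρ n).toTopRep) :
    S.redCocycle₂ (S.le_refl n) f = f :=
  Subtype.ext (ContinuousMap.ext fun p => S.red_refl n (f.1 p))

omit [IsTopologicalGroup G] [LocallyCompactSpace G] in
/-- Functoriality of `redCocycle₂`: composition. [cite: NeukirchSchmidtWingberg2008, II §7 Thm 2.7.5] -/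
theorem redCocycle₂_trans {a b d : ι} (h₁ : S.le a b) (h₂ : S.le b d)
    (f : contTwoCocycles (S.ρ d).toTopRep) :
    S.redCocycle₂ (S.le_trans h₁ h₂) f = S.redCocycle₂ h₁ (S.redCocycle₂ h₂ f) :=
  Subtype.ext (ContinuousMap.ext fun p => S.red_trans h₁ h₂ (f.1 p))

omit [IsTopologicalGroup G] [LocallyCompactSpace G] in
/-- Projections of a cocycle of the limit are compatible. [cite: NeukirchSchmidtWingberg2008, II §7 Thm 2.7.5] -/
theorem redCocycle₂_projCocycle₂ {n m : ι} (h : S.le n m) (f : contTwoCocycles S.limitRep.toTopRep) :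
    S.redCocycle₂ h (S.projCocycle₂ m f) = S.projCocycle₂ n f :=
  Subtype.ext (ContinuousMap.ext fun p => S.red_apply_coe (f.1 p) h)

omit [IsTopologicalGroup G] [LocallyCompactSpace G] in
/-- **A compatible family of continuous `2`-cocycles defines a continuous `2`-cocycle of the limit.**
[cite: NeukirchSchmidtWingberg2008, II §7 Thm 2.7.5] -/
def limitCocycle₂ (f : ∀ n, contTwoCocycles (S.ρ n).toTopRep)
    (hf : ∀ {n m : ι} (h : S.le n m), S.redCocycle₂ h (f m) = f n) :
    contTwoCocycles S.limitRep.toTopRep :=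
  ⟨⟨fun p => ⟨fun n => (f n).1 p, fun n m h => by
      have := congrArg (fun g : contTwoCocycles (S.ρ n).toTopRep => g.1 p) (hf h)
      exact this⟩,
    continuous_induced_rng.2 (continuous_pi fun n => (f n).1.continuous)⟩,
    fun σ τ υ => Subtype.ext (funext fun n => (f n).2 σ τ υ)⟩

omit [IsTopologicalGroup G] [LocallyCompactSpace G] in
/-- The projections of `limitCocycle₂ f` are the `f n`. [cite: NeukirchSchmidtWingberg2008, II §7 Thm 2.7.5] -/
@[simp] theorem projCocycle₂_limitCocycle₂ (f : ∀ n, contTwoCocycles (S.ρ n).toTopRep)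
    (hf : ∀ {n m : ι} (h : S.le n m), S.redCocycle₂ h (f m) = f n) (n : ι) :
    S.projCocycle₂ n (S.limitCocycle₂ f hf) = f n :=
  Subtype.ext (ContinuousMap.ext fun _ => rfl)

/-- `H²(red) [f] = [red f]`. [cite: NeukirchSchmidtWingberg2008, II §7 Thm 2.7.5] -/
theorem cohomologyMap_redHom_twoCocycleClass {n m : ι} (h : S.le n m)
    (f : contTwoCocycles (S.ρ m).toTopRep) :
    cohomologyMap (S.redHom h) 2 (twoCocycleClass _ f) = twoCocycleClass _ (S.redCocycle₂ h f) :=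
  cohomologyMap_twoCocycleClass _ f

/-- `H²(proj n) [f] = [proj n f]`. [cite: NeukirchSchmidtWingberg2008, II §7 Thm 2.7.5] -/
theorem cohomologyMap_projHom_twoCocycleClass (n : ι) (f : contTwoCocycles S.limitRep.toTopRep) :
    cohomologyMap (S.projHom n) 2 (twoCocycleClass _ f) = twoCocycleClass _ (S.projCocycle₂ n f) :=
  cohomologyMap_twoCocycleClass _ f

/-! ### Surjectivity: exact lifting of cocycles along a cofinal chain -/

/-- **One step of exact lifting**: if `[red g] = [t]` then some cocycle `g'` with `[g'] = [g]` has
`red g' = t` ON THE NOSE (subtract the coboundary of a continuous lift of `b`, where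
`red g - t = ∂b`). [cite: NeukirchSchmidtWingberg2008, II §7 Thm 2.7.5] -/
theorem exists_redCocycle₂_eq {n m : ι} (h : S.le n m) (hs : Surjective (S.red h))
    (g : contTwoCocycles (S.ρ m).toTopRep) (t : contTwoCocycles (S.ρ n).toTopRep)
    (hgt : twoCocycleClass _ (S.redCocycle₂ h g) = twoCocycleClass _ t) :
    ∃ g' : contTwoCocycles (S.ρ m).toTopRep,
      twoCocycleClass _ g' = twoCocycleClass _ g ∧ S.redCocycle₂ h g' = t := by
  have h0 : twoCocycleClass _ (S.redCocycle₂ h g - t) = 0 := by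
    rw [twoCocycleClass_sub, hgt, sub_self]
  obtain ⟨b, hb⟩ := (twoCocycleClass_eq_zero_iff _ _).1 h0
  obtain ⟨b', hb'⟩ := S.exists_lift h hs b
  refine ⟨g - (S.ρ m).twoCoboundary b', ?_, ?_⟩
  · rw [twoCocycleClass_sub, ContinuousRep.twoCocycleClass_twoCoboundary, sub_zero]
  · refine Subtype.ext (ContinuousMap.ext fun p => ?_)
    obtain ⟨σ, τ⟩ := p
    have hbst : S.red h (g.1 (σ, τ)) - t.1 (σ, τ) = S.ρ n σ (b τ) - b (σ * τ) + b σ := hb σ τ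
    change S.red h (g.1 (σ, τ) - (S.ρ m σ (b' τ) - b' (σ * τ) + b' σ)) = t.1 (σ, τ)
    rw [map_sub, map_add, map_sub, S.red_smul, hb', hb', hb', ← hbst]
    abel


/-- **Surjectivity of `H²_cont(G, lim_n M_n) → lim_n H²(G, M_n)`** (surjective transitions, a
cofinal chain): every family of classes `x_n ∈ H²(G, M_n)` compatible under the transition maps is
the family of projections of the class of ONE continuous `2`-cocycle of the limit.  Proof: exact
lifting of representatives along the chain (`exists_redCocycle₂_eq`), extension to all indices,
assembly (`limitCocycle₂`). [cite: NeukirchSchmidtWingberg2008, II §7 Thm 2.7.5] -/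
theorem exists_twoCocycle_proj_eq (c : S.CofinalChain)
    (hs : ∀ {n m : ι} (h : S.le n m), Surjective (S.red h))
    (x : ∀ n, continuousCohomology 2 (S.ρ n).toTopRep)
    (hx : ∀ {n m : ι} (h : S.le n m), cohomologyMap (S.redHom h) 2 (x m) = x n) :
    ∃ f : contTwoCocycles S.limitRep.toTopRep,
      ∀ n, twoCocycleClass _ (S.projCocycle₂ n f) = x n := by
  classical
  choose g hg using fun n => twoCocycleClass_surjective (S.ρ n).toTopRep (x n)
  -- exact lifting along the chain
  let T : ℕ → Type v := fun i =>
    {f : contTwoCocycles (S.ρ (c.seq i)).toTopRep // twoCocycleClass _ f = x (c.seq i)}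
  have hstep : ∀ (i : ℕ) (t : T i), ∃ t' : T (i + 1), S.redCocycle₂ (c.le_succ i) t'.1 = t.1 := by
    intro i t
    obtain ⟨g', hg'cl, hg'red⟩ := S.exists_redCocycle₂_eq (c.le_succ i) (hs _)
      (g (c.seq (i + 1))) t.1
      (by rw [← S.cohomologyMap_redHom_twoCocycleClass, hg, hx, t.2])
    exact ⟨⟨g', hg'cl.trans (hg _)⟩, hg'red⟩
  choose step hstep using hstep
  let F : ∀ i, T i := fun i => Nat.rec (motive := T) ⟨g (c.seq 0), hg _⟩ (fun i t => step i t) i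
  have hF : ∀ i, S.redCocycle₂ (c.le_succ i) (F (i + 1)).1 = (F i).1 := fun i => hstep i (F i)
  -- extension to all indices
  obtain ⟨z, hz, hzF⟩ := S.exists_extend c (β := fun n => contTwoCocycles (S.ρ n).toTopRep)
    (fun h f => S.redCocycle₂ h f) (fun n f => S.redCocycle₂_refl n f)
    (fun h₁ h₂ f => S.redCocycle₂_trans h₁ h₂ f) (fun i => (F i).1) hF
  refine ⟨S.limitCocycle₂ z hz, fun n => ?_⟩
  have hzn : S.redCocycle₂ (c.le_idx n) (z (c.seq (c.idx n))) = z n := hz (c.le_idx n)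
  rw [S.projCocycle₂_limitCocycle₂, ← hzn, hzF, ← S.cohomologyMap_redHom_twoCocycleClass,
    (F (c.idx n)).2, hx]

/-- **Injectivity of `H²_cont(G, lim_n M_n) → lim_n H²(G, M_n)` for finite `Z¹(G, M_n)`**: a
continuous `2`-cocycle of the limit whose projections along a cofinal chain are coboundaries is a
coboundary.  Proof: the sets of continuous solutions `b` of `∂b = f_i` are finite (torsors under
the finite `Z¹(G, M_{c i})`) and non-empty, so (König, Mathlib's
`nonempty_sections_of_finite_inverse_system`) there is a compatible family of solutions; it extends
to all indices and assembles to a continuous `1`-cochain of the limit bounding `f`.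
[cite: NeukirchSchmidtWingberg2008, II §7 Thm 2.7.5] -/
theorem twoCocycleClass_eq_zero_of_proj (c : S.CofinalChain)
    (hfin : ∀ n, Finite (contOneCocycles (S.ρ n).toTopRep))
    (f : contTwoCocycles S.limitRep.toTopRep)
    (hf : ∀ i, twoCocycleClass _ (S.projCocycle₂ (c.seq i) f) = 0) :
    twoCocycleClass _ f = 0 := by
  classical
  -- the solution sets `∂b = f_i` along the chain
  let Sol : ℕ → Type v := fun i => {b : C(G, M (c.seq i)) //
    ∀ σ τ, (S.projCocycle₂ (c.seq i) f).1 (σ, τ) = S.ρ (c.seq i) σ (b τ) - b (σ * τ) + b σ}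
  have hne : ∀ i, Nonempty (Sol i) := fun i => by
    obtain ⟨b, hb⟩ := (twoCocycleClass_eq_zero_iff _ _).1 (hf i)
    exact ⟨⟨b, hb⟩⟩
  have hfinSol : ∀ i, Finite (Sol i) := fun i => by
    obtain ⟨b₀⟩ := hne i
    haveI := hfin (c.seq i)
    refine Finite.of_injective (fun b : Sol i =>
      (⟨b.1 - b₀.1, fun g h => ?_⟩ : contOneCocycles (S.ρ (c.seq i)).toTopRep)) ?_
    · have E : S.ρ _ g (b.1 h) - b.1 (g * h) + b.1 g = S.ρ _ g (b₀.1 h) - b₀.1 (g * h) + b₀.1 g :=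
        (b.2 g h).symm.trans (b₀.2 g h)
      change (b.1 - b₀.1) (g * h) = (b.1 - b₀.1) g + S.ρ _ g ((b.1 - b₀.1) h)
      simp only [ContinuousMap.sub_apply, map_sub]
      rw [← sub_eq_zero] at E ⊢
      rw [← neg_eq_zero, ← E]
      abel
    · intro b₁ b₂ hb
      have h1 := congrArg (fun φ : contOneCocycles (S.ρ (c.seq i)).toTopRep => φ.1) hb
      exact Subtype.ext (sub_left_inj.1 h1)
  -- the inverse system of solution sets along the chain
  have hmem : ∀ {i j : ℕ} (hji : j ≤ i) (b : Sol i) (σ τ : G),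
      (S.projCocycle₂ (c.seq j) f).1 (σ, τ) =
        S.ρ (c.seq j) σ (S.red (c.le_of_le hji) (b.1 τ)) - S.red (c.le_of_le hji) (b.1 (σ * τ)) +
          S.red (c.le_of_le hji) (b.1 σ) := by
    intro i j hji b σ τ
    rw [← S.red_smul, ← map_sub, ← map_add, ← b.2 σ τ]
    exact (S.red_apply_coe (f.1 (σ, τ)) (c.le_of_le hji)).symm
  let F : ℕᵒᵖ ⥤ Type v :=
    { obj := fun i => Sol i.unop
      map := fun {i j} φ => TypeCat.ofHom fun b : Sol i.unop =>
        (⟨(⟨S.red (c.le_of_le φ.unop.le), continuous_of_discreteTopology⟩ : C(_, _)).comp b.1,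
          hmem φ.unop.le b⟩ : Sol j.unop)
      map_id := fun i => ConcreteCategory.hom_ext _ _ fun b =>
        Subtype.ext (ContinuousMap.ext fun σ => S.red_refl _ _)
      map_comp := fun φ ψ => ConcreteCategory.hom_ext _ _ fun b =>
        Subtype.ext (ContinuousMap.ext fun σ => S.red_trans _ _ _) }
  haveI : ∀ j : ℕᵒᵖ, Finite (F.obj j) := fun j => hfinSol j.unop
  haveI : ∀ j : ℕᵒᵖ, Nonempty (F.obj j) := fun j => hne j.unop
  obtain ⟨u, hu⟩ := nonempty_sections_of_finite_inverse_system F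
  -- the compatible chain of solutions and its extension to all indices
  let yb : ∀ i, C(G, M (c.seq i)) := fun i => (u (op i)).1
  have hyb : ∀ i, (⟨S.red (c.le_succ i), continuous_of_discreteTopology⟩ : C(_, _)).comp
      (yb (i + 1)) = yb i := fun i =>
    congrArg Subtype.val (hu (CategoryTheory.homOfLE (Nat.le_succ i)).op)
  obtain ⟨B, hB, hBy⟩ := S.exists_extend c (β := fun n => C(G, M n))
    (fun h b => (⟨S.red h, continuous_of_discreteTopology⟩ : C(_, _)).comp b)
    (fun n b => ContinuousMap.ext fun σ => S.red_refl n (b σ))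
    (fun h₁ h₂ b => ContinuousMap.ext fun σ => S.red_trans h₁ h₂ (b σ)) yb hyb
  have hBval : ∀ {n m : ι} (h : S.le n m) (σ : G), S.red h (B m σ) = B n σ := fun h σ =>
    congrArg (fun b : C(G, _) => b σ) (hB h)
  -- the bounding continuous `1`-cochain of the limit
  let Bc : C(G, S.limit) :=
    ⟨fun σ => ⟨fun n => B n σ, fun n m h => hBval h σ⟩,
      continuous_induced_rng.2 (continuous_pi fun n => (B n).continuous)⟩
  refine (twoCocycleClass_eq_zero_iff _ _).2 ⟨Bc, fun σ τ => Subtype.ext (funext fun n => ?_)⟩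
  change ((f.1 (σ, τ) : S.limit) : ∀ n, M n) n = S.ρ n σ (B n τ) - B n (σ * τ) + B n σ
  have hBn : ∀ σ', B n σ' = S.red (c.le_idx n) (yb (c.idx n) σ') := fun σ' => by
    rw [← hBval (c.le_idx n) σ', hBy]
  rw [← S.red_apply_coe (f.1 (σ, τ)) (c.le_idx n), hBn, hBn, hBn, ← S.red_smul, ← map_sub,
    ← map_add]
  exact congrArg (S.red (c.le_idx n)) ((u (op (c.idx n))).2 σ τ)


omit [LocallyCompactSpace G] in
/-- **`lim_n H^q(G, M_n)`**: the group of families of classes compatible under the transition maps.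
[cite: NeukirchSchmidtWingberg2008, II §7 Thm 2.7.5] -/
def cohomologyLimit (q : ℕ) : AddSubgroup (∀ n, continuousCohomology q (S.ρ n).toTopRep) where
  carrier := {x | ∀ ⦃n m : ι⦄ (h : S.le n m), cohomologyMap (S.redHom h) q (x m) = x n}
  zero_mem' := fun n m h => by simp
  add_mem' := fun {x y} hx hy n m h => by simp [map_add, hx h, hy h]
  neg_mem' := fun {x} hx n m h => by simp [map_neg, hx h]

omit [LocallyCompactSpace G] in
/-- Membership in `lim_n H^q(G, M_n)`. [cite: NeukirchSchmidtWingberg2008, II §7 Thm 2.7.5] -/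
theorem mem_cohomologyLimit_iff (q : ℕ) (x : ∀ n, continuousCohomology q (S.ρ n).toTopRep) :
    x ∈ S.cohomologyLimit q ↔ ∀ ⦃n m : ι⦄ (h : S.le n m), cohomologyMap (S.redHom h) q (x m) = x n :=
  Iff.rfl

/-- **The comparison map `H²_cont(G, lim_n M_n) → lim_n H²(G, M_n)`**, `y ↦ (H²(proj_n) y)_n`.
[cite: NeukirchSchmidtWingberg2008, II §7 Thm 2.7.5] -/
def toCohomologyLimit₂ : continuousCohomology 2 S.limitRep.toTopRep →+ S.cohomologyLimit 2 where
  toFun y := ⟨fun n => cohomologyMap (S.projHom n) 2 y, fun n m h => by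
    obtain ⟨f, rfl⟩ := twoCocycleClass_surjective _ y
    change cohomologyMap (S.redHom h) 2 (cohomologyMap (S.projHom m) 2 (twoCocycleClass _ f)) =
      cohomologyMap (S.projHom n) 2 (twoCocycleClass _ f)
    rw [cohomologyMap_projHom_twoCocycleClass, cohomologyMap_projHom_twoCocycleClass,
      cohomologyMap_redHom_twoCocycleClass, redCocycle₂_projCocycle₂]⟩
  map_zero' := Subtype.ext (funext fun n => by simp)
  map_add' y y' := Subtype.ext (funext fun n => by simp [map_add])

/-- Coordinates of the comparison map. [cite: NeukirchSchmidtWingberg2008, II §7 Thm 2.7.5] -/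
@[simp] theorem coe_toCohomologyLimit₂_apply (y : continuousCohomology 2 S.limitRep.toTopRep) (n : ι) :
    (S.toCohomologyLimit₂ y : ∀ n, continuousCohomology 2 (S.ρ n).toTopRep) n =
      cohomologyMap (S.projHom n) 2 y := rfl

/-- **Surjectivity** of `H²_cont(G, lim_n M_n) → lim_n H²(G, M_n)` (surjective transition maps, a
cofinal chain). [cite: NeukirchSchmidtWingberg2008, II §7 Thm 2.7.5] -/
theorem toCohomologyLimit₂_surjective (c : S.CofinalChain)
    (hs : ∀ {n m : ι} (h : S.le n m), Surjective (S.red h)) :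
    Surjective S.toCohomologyLimit₂ := by
  intro x
  obtain ⟨f, hf⟩ := S.exists_twoCocycle_proj_eq c hs x.1 (fun h => x.2 h)
  refine ⟨twoCocycleClass _ f, Subtype.ext (funext fun n => ?_)⟩
  rw [coe_toCohomologyLimit₂_apply, cohomologyMap_projHom_twoCocycleClass, hf]

/-- **Injectivity** of `H²_cont(G, lim_n M_n) → lim_n H²(G, M_n)` when the groups of continuous
crossed homomorphisms `Z¹(G, M_n)` are finite (e.g. `M_n` and `H¹(G, M_n)` finite).
[cite: NeukirchSchmidtWingberg2008, II §7 Thm 2.7.5] -/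
theorem toCohomologyLimit₂_injective (c : S.CofinalChain)
    (hfin : ∀ n, Finite (contOneCocycles (S.ρ n).toTopRep)) :
    Injective S.toCohomologyLimit₂ := by
  refine (injective_iff_map_eq_zero _).2 fun y hy => ?_
  obtain ⟨f, rfl⟩ := twoCocycleClass_surjective _ y
  refine S.twoCocycleClass_eq_zero_of_proj c hfin f fun i => ?_
  have h := congrArg (fun x : S.cohomologyLimit 2 =>
    (x : ∀ n, continuousCohomology 2 (S.ρ n).toTopRep) (c.seq i)) hy
  simpa [cohomologyMap_projHom_twoCocycleClass] using h

/-- **`H²_cont(G, lim_n M_n) ≃ lim_n H²(G, M_n)`** (NSW Cor. 2.7.6 in degree `2`): for an inverse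
system of discrete `G`-modules with surjective transition maps over an index set with a cofinal
chain, `G` locally compact, and finite `Z¹(G, M_n)` for all `n`, the comparison map is an
isomorphism of abelian groups. [cite: NeukirchSchmidtWingberg2008, II §7 Thm 2.7.5] -/
def continuousCohomologyTwoLimitEquiv (c : S.CofinalChain)
    (hs : ∀ {n m : ι} (h : S.le n m), Surjective (S.red h))
    (hfin : ∀ n, Finite (contOneCocycles (S.ρ n).toTopRep)) :
    continuousCohomology 2 S.limitRep.toTopRep ≃+ S.cohomologyLimit 2 :=
  AddEquiv.ofBijective S.toCohomologyLimit₂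
    ⟨S.toCohomologyLimit₂_injective c hfin, S.toCohomologyLimit₂_surjective c hs⟩

/-- Coordinates of the comparison isomorphism. [cite: NeukirchSchmidtWingberg2008, II §7 Thm 2.7.5] -/
@[simp] theorem coe_continuousCohomologyTwoLimitEquiv_apply (c : S.CofinalChain)
    (hs : ∀ {n m : ι} (h : S.le n m), Surjective (S.red h))
    (hfin : ∀ n, Finite (contOneCocycles (S.ρ n).toTopRep))
    (y : continuousCohomology 2 S.limitRep.toTopRep) (n : ι) :
    (S.continuousCohomologyTwoLimitEquiv c hs hfin y : ∀ n, continuousCohomology 2 (S.ρ n).toTopRep) n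
      = cohomologyMap (S.projHom n) 2 y := rfl

end DiscreteInvSystem

end Literature.NumberTheory.GaloisRepresentations
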